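import Mathlib
import HarnessLib
import Summits.NavierStokesRegularity.NavierStokesRegularity.Theorems.TaylorModelRungThreeCertificateFormatVGrowthPairs

/-!
# Crux K1b-DR (stmt-NavierStokesRegularity-23954), line `taylor-model` — v3 growth checker, SOUNDNESS part 3:
# (R2), (R0), (R1) and the composer's inputs for all stages (tm-g4 g4)

`wVec_nonneg`, **`transport_bound`** (an admissible chain from `s₀` to the boundary `(s₀/L+1+m)·L` maps the `r·ω`-ball into the
box `r·wVec m` — `absLeW_kiter_of_prodMem` per leg, the verified claims `ũ`/`T̃`, `kiter_add`), **`hR2_inChunk`**, **`hR2_cross`**,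
**`hR2_of_growth`** — clause (R2) for all pairs; `hR1_of_check` ((R1) via `inBox_hull2_of_hull1_add` and `Λdes·κ·ω ≤ tubeW ≤ wT`),
`face0_of_test`, `hR0_of_check` ((R0 a–d)); `hR0_all … hR3b_all`, `steps_of_growth` — the inputs of `readoutsV_of_checks` /
`k1bDR_of_checksVR` for all stages (binders verbatim), plus `ChecksOK.steps` and the caller's per-sub-step predicate from the same
chunk runs. MODEL-lattice bookkeeping only (rung TL-M3); nothing here is a statement about the Navier–Stokes equations; K1b-DR is
NOT proved here (that needs an emitted certificate whose Booleans evaluate to `true`).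
-/

-- the sub-problem namespace repeats the summit name by design (D-0017)
set_option linter.dupNamespace false

namespace Summit.NavierStokesRegularity.NavierStokesRegularity.Theorems.TaylorModelCert

open scoped BigOperators
open Literature.Analysis.FluidPDE.TaoCascade Literature.Analysis.FluidPDE.TaoCascade.TaylorChain
open Summit.NavierStokesRegularity.NavierStokesRegularity.Theorems.TaylorModelReadout
open Summit.NavierStokesRegularity.NavierStokesRegularity.Theorems.TaylorModelV

namespace CertTablesV

variable {TV : CertTablesV} {kitOf : ℕ → CoreKit} {wT : ℕ → Array Dyad} {sc : ScalarsV}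

/-! ### From the chunk Booleans to (R2) -/

section Stage

variable {P : ℕ → CoreOut → Bool} {j L : ℕ} (hL : 0 < L)
  (hGR : ∀ q, q * L < TV.S j → TV.growthRange kitOf wT P j L q = true)
include hL hGR


variable (hω : ∀ k, 0 < (TV.toCertDataVW kitOf wT sc).ω j k)
include hω

omit hL hGR hω in
/-- Row sums against `ω` are below row sums against `ω↑`. [folklore] -/
theorem rowsum_omega_le_ωhi (P : Array (Array IntervalD)) {r : ℕ} (_hr : r < TV.base.n) :
    ∑ t ∈ Finset.range TV.base.n, (IntervalD.mag (imget P r t)).toReal * (TV.toCertDataVW kitOf wT sc).ω j (TV.base.wk t) ≤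
      ∑ t ∈ Finset.range TV.base.n, (IntervalD.mag (imget P r t)).toReal * vre (TV.ωhiV j) t :=
  Finset.sum_le_sum fun _ ht =>
    mul_le_mul_of_nonneg_left (omega_le_ωhi (sc := sc) j (Finset.mem_range.1 ht)) (IntervalD.mag_nonneg _)

omit hL hGR in
/-- **(R2), in-chunk pairs.** [folklore] -/
theorem hR2_inChunk {s₀ s₁ : ℕ} (h01 : s₀ ≤ s₁) (hin : s₁ ≤ (s₀ / L + 1) * L) (Ac : ℕ → Ker)
    (hA : ∀ s', s₀ ≤ s' → s' < s₁ →
      KerMem (TV.toCertDataVW kitOf wT sc) (Ac s') ((TV.toBoxesW kitOf wT).Mlo j s') ((TV.toBoxesW kitOf wT).Mhi j s'))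
    (v : Fin 4 → ℤ → ℝ) (r : ℝ) (hr : 0 ≤ r) (hv : (TV.toCertDataVW kitOf wT sc).InBall j v r) :
    (TV.toCertDataVW kitOf wT sc).InBall j (kiter (TV.toCertDataVW kitOf wT sc) Ac s₀ (s₁ - s₀) v)
      (TV.Gr kitOf wT j L s₀ s₁ * r) := by
  unfold Gr gD
  rw [if_pos hin]
  refine TV.base.inBall_kiter_of_memMat cd_Kb cd_Ka
    (memMat_prodM (sc := sc) (s₁ - s₀) fun s' h1 h2 => hA s' h1 (by omega)) (fun r' hr' => ?_) hr hv
  exact (rowsum_omega_le_ωhi (sc := sc) (j := j) _ hr').trans (rowsum_le_facOf (sc := sc) j L _ hω _ _ hr')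

/-- The emitted/transported start vectors are nonnegative (where the claims hold). [folklore] -/
theorem wVec_nonneg {s₀ : ℕ} :
    ∀ m : ℕ, (s₀ / L + 1 + m) * L < TV.S j → ∀ c < TV.base.n, 0 ≤ vre (TV.wVec j L s₀ m) c
  | 0, hm, c, hc => by
    have h1 : s₀ / L * L ≤ s₀ := Nat.div_mul_le_self s₀ L
    have h2 : s₀ < s₀ / L * L + L := Nat.lt_div_mul_add hL
    have hcl := (claims_sound (TV := TV) (kitOf := kitOf) (wT := wT) (hGR (s₀ / L) (by nlinarith)) hL (by simpa using hm)).2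
      s₀ h1 (by linarith) c hc
    refine le_trans ?_ hcl
    refine le_trans (Finset.sum_nonneg fun t ht => ?_) (sum_le_absMulVecUp TV.prec (fun r hr t ht => by rw [dre_magM _ hr ht]) hc)
    exact mul_nonneg (IntervalD.mag_nonneg _)
      ((hω _).le.trans (omega_le_ωhi (sc := sc) j (Finset.mem_range.1 ht)))
  | m + 1, hm, c, hc => by
    have hm' : (s₀ / L + 1 + m) * L < TV.S j := by nlinarith
    have ih := wVec_nonneg m hm'
    have hcl := (claims_sound (TV := TV) (kitOf := kitOf) (wT := wT) (hGR (s₀ / L + 1 + m) hm') hL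
      (by simpa [Nat.add_assoc] using hm)).1
    show 0 ≤ vre (absMulVecUp TV.base.n TV.prec (TV.gT j (s₀ / L + 1 + m)) (TV.wVec j L s₀ m)) c
    refine le_trans (Finset.sum_nonneg fun t ht => ?_) (sum_le_absMulVecUp TV.prec (fun r hr t ht => le_rfl) hc)
    have ht' := Finset.mem_range.1 ht
    exact mul_nonneg ((magM_nonneg _ hc ht').trans (hcl c hc t ht')) (ih t ht')

/-- **TRANSPORT ACROSS CHUNKS**: an admissible chain from `s₀` up to the boundary `(s₀/L + 1 + m)·L` maps the `r·ω`-ball into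
the box `r · wVec m` (coordinatewise), provided the claims of the chunks involved hold. [folklore] -/
theorem transport_bound {s₀ : ℕ} :
    ∀ m : ℕ, (s₀ / L + 1 + m) * L < TV.S j → ∀ Ac : ℕ → Ker,
      (∀ s', s₀ ≤ s' → s' < (s₀ / L + 1 + m) * L →
        KerMem (TV.toCertDataVW kitOf wT sc) (Ac s') ((TV.toBoxesW kitOf wT).Mlo j s') ((TV.toBoxesW kitOf wT).Mhi j s')) →
      ∀ (v : Fin 4 → ℤ → ℝ) (r : ℝ), 0 ≤ r → (TV.toCertDataVW kitOf wT sc).InBall j v r →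
        AbsLeW (TV.toCertDataVW kitOf wT sc) (kiter (TV.toCertDataVW kitOf wT sc) Ac s₀ ((s₀ / L + 1 + m) * L - s₀) v)
          (fun i k => r * vre (TV.wVec j L s₀ m) (TV.base.idx i k))
  | 0, hm, Ac, hA, v, r, hr, hv => by
    have h1 : s₀ / L * L ≤ s₀ := Nat.div_mul_le_self s₀ L
    have h2 : s₀ < s₀ / L * L + L := Nat.lt_div_mul_add hL
    simp only [Nat.add_zero] at hA ⊢
    set P := TV.prodM kitOf wT j s₀ ((s₀ / L + 1) * L - s₀) with hP
    have hmem := memMat_prodM (sc := sc) (j := j) (a := s₀) (A := Ac) ((s₀ / L + 1) * L - s₀) fun s' h1' h2' => hA s' h1' (by omega)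
    have hK := TV.base.kerMem_of_memMat_kiter cd_Kb cd_Ka hmem
    have hb := absLeW_kiter_of_prodMem hK (v := v) (b := fun i k => r * (TV.toCertDataVW kitOf wT sc).ω j k)
      (fun i k hk1 hk2 => hv i k hk1 hk2)
    intro i' k' hk1' hk2'
    refine (hb i' k' hk1' hk2').trans ?_
    -- the window sum in coordinates, then the claim `… ≤ ũ_{s₀}`
    have hcl := (claims_sound (TV := TV) (kitOf := kitOf) (wT := wT) (hGR (s₀ / L) (by nlinarith)) hL (by simpa using hm)).2
      s₀ h1 (by linarith)
    have hrow : ∀ r' < TV.base.n, ∑ t ∈ Finset.range TV.base.n,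
        (IntervalD.mag (imget P r' t)).toReal * (r * (TV.toCertDataVW kitOf wT sc).ω j (TV.base.wk t)) ≤
        r * vre (TV.gU j s₀) r' := by
      intro r' hr'
      have e : ∑ t ∈ Finset.range TV.base.n, (IntervalD.mag (imget P r' t)).toReal * (r * (TV.toCertDataVW kitOf wT sc).ω j (TV.base.wk t))
          = r * ∑ t ∈ Finset.range TV.base.n, (IntervalD.mag (imget P r' t)).toReal * (TV.toCertDataVW kitOf wT sc).ω j (TV.base.wk t) := by
        rw [Finset.mul_sum]; exact Finset.sum_congr rfl fun t _ => by ring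
      rw [e]
      refine mul_le_mul_of_nonneg_left ?_ hr
      refine (rowsum_omega_le_ωhi (sc := sc) (j := j) P hr').trans ?_
      exact (sum_le_absMulVecUp TV.prec (fun r hr t ht => by rw [dre_magM _ hr ht]) hr').trans (hcl r' hr')
    have hw := TV.base.rowsum_window_le_of_coord cd_Kb cd_Ka P (fun t => r * (TV.toCertDataVW kitOf wT sc).ω j (TV.base.wk t))
      (fun r' => r * vre (TV.gU j s₀) r') hrow i' hk1' hk2'
    refine le_trans (le_of_eq (Finset.sum_congr rfl fun c _ => ?_)) hw
    rw [TV.base.wk_idx _ (by rw [← cd_Kb (TV := TV) (kitOf := kitOf) (wT := wT) (sc := sc),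
      ← cd_Ka (TV := TV) (kitOf := kitOf) (wT := wT) (sc := sc)]; exact shellOf_mem _ c)]
  | m + 1, hm, Ac, hA, v, r, hr, hv => by
    have h2 : s₀ < s₀ / L * L + L := Nat.lt_div_mul_add hL
    have hm' : (s₀ / L + 1 + m) * L < TV.S j := by nlinarith
    set q' := s₀ / L + 1 + m with hq'
    have hs₀q : s₀ ≤ q' * L := by nlinarith
    have ih := transport_bound m hm' Ac (fun s' h1' h2' => hA s' h1' (by nlinarith)) v r hr hv
    -- split the chain at `q'L`
    have e1 : (s₀ / L + 1 + (m + 1)) * L - s₀ = (q' * L - s₀) + L := by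
      have : (s₀ / L + 1 + (m + 1)) * L = q' * L + L := by rw [hq']; ring
      omega
    rw [e1, kiter_add, show s₀ + (q' * L - s₀) = q' * L by omega]
    -- the leg over chunk `q'`
    have hmem := memMat_prodM (sc := sc) (j := j) (a := q' * L) (A := Ac) L fun s' h1' h2' =>
      hA s' (by omega) (by nlinarith)
    have hK := TV.base.kerMem_of_memMat_kiter cd_Kb cd_Ka hmem
    have hb := absLeW_kiter_of_prodMem hK ih
    intro i' k' hk1' hk2'
    refine (hb i' k' hk1' hk2').trans ?_
    have hcl := (claims_sound (TV := TV) (kitOf := kitOf) (wT := wT) (hGR q' hm') hL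
      (by simpa [hq', Nat.add_assoc] using hm)).1
    have hwnn := wVec_nonneg (TV := TV) (kitOf := kitOf) (wT := wT) (sc := sc) hL hGR hω (s₀ := s₀) m hm'
    have hrow : ∀ r' < TV.base.n, ∑ t ∈ Finset.range TV.base.n,
        (IntervalD.mag (imget (TV.prodM kitOf wT j (q' * L) L) r' t)).toReal * (r * vre (TV.wVec j L s₀ m) t) ≤
        r * vre (TV.wVec j L s₀ (m + 1)) r' := by
      intro r' hr'
      have e : ∑ t ∈ Finset.range TV.base.n,
          (IntervalD.mag (imget (TV.prodM kitOf wT j (q' * L) L) r' t)).toReal * (r * vre (TV.wVec j L s₀ m) t) =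
          r * ∑ t ∈ Finset.range TV.base.n,
            (IntervalD.mag (imget (TV.prodM kitOf wT j (q' * L) L) r' t)).toReal * vre (TV.wVec j L s₀ m) t := by
        rw [Finset.mul_sum]; exact Finset.sum_congr rfl fun t _ => by ring
      rw [e]
      refine mul_le_mul_of_nonneg_left ?_ hr
      show _ ≤ vre (absMulVecUp TV.base.n TV.prec (TV.gT j (s₀ / L + 1 + m)) (TV.wVec j L s₀ m)) r'
      refine le_trans (Finset.sum_le_sum fun t ht => ?_) (sum_le_absMulVecUp TV.prec (fun r hr t ht => le_rfl) hr')
      have ht' := Finset.mem_range.1 ht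
      rw [← dre_magM _ hr' ht']
      exact mul_le_mul_of_nonneg_right (hcl r' hr' t ht') (hwnn t ht')
    exact TV.base.rowsum_window_le_of_coord cd_Kb cd_Ka _ (fun t => r * vre (TV.wVec j L s₀ m) t)
      (fun r' => r * vre (TV.wVec j L s₀ (m + 1)) r') hrow i' hk1' hk2'

/-- **(R2), cross-chunk pairs.** [folklore] -/
theorem hR2_cross {s₀ s₁ : ℕ} (hS : s₁ ≤ TV.S j) (hout : ¬ s₁ ≤ (s₀ / L + 1) * L) (Ac : ℕ → Ker)
    (hA : ∀ s', s₀ ≤ s' → s' < s₁ →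
      KerMem (TV.toCertDataVW kitOf wT sc) (Ac s') ((TV.toBoxesW kitOf wT).Mlo j s') ((TV.toBoxesW kitOf wT).Mhi j s'))
    (v : Fin 4 → ℤ → ℝ) (r : ℝ) (hr : 0 ≤ r) (hv : (TV.toCertDataVW kitOf wT sc).InBall j v r) :
    (TV.toCertDataVW kitOf wT sc).InBall j (kiter (TV.toCertDataVW kitOf wT sc) Ac s₀ (s₁ - s₀) v)
      (TV.Gr kitOf wT j L s₀ s₁ * r) := by
  have h2 : s₀ < s₀ / L * L + L := Nat.lt_div_mul_add hL
  push Not at hout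
  set qb := (s₁ - 1) / L with hqb
  have hb1 : qb * L ≤ s₁ - 1 := Nat.div_mul_le_self _ L
  have hb2 : s₁ - 1 < qb * L + L := Nat.lt_div_mul_add hL
  have hq : s₀ / L + 1 ≤ qb := (Nat.le_div_iff_mul_le hL).2 (by omega)
  obtain ⟨M, hM⟩ := Nat.exists_eq_add_of_le hq
  have hmS : (s₀ / L + 1 + M) * L < TV.S j := by rw [← hM]; omega
  have ht := transport_bound (TV := TV) (kitOf := kitOf) (wT := wT) (sc := sc) hL hGR hω M hmS Ac
    (fun s' h1' h2' => hA s' h1' (by rw [← hM] at h2'; omega)) v r hr hv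
  rw [← hM] at ht
  -- split at `qb·L`
  have hs₀ : s₀ ≤ qb * L := by rw [hM]; nlinarith
  have e1 : s₁ - s₀ = (qb * L - s₀) + (s₁ - qb * L) := by omega
  rw [e1, kiter_add, show s₀ + (qb * L - s₀) = qb * L by omega]
  have hmem := memMat_prodM (sc := sc) (j := j) (a := qb * L) (A := Ac) (s₁ - qb * L) fun s' h1' h2' =>
    hA s' (by omega) (by omega)
  have hK := TV.base.kerMem_of_memMat_kiter cd_Kb cd_Ka hmem
  have hb := absLeW_kiter_of_prodMem hK ht
  unfold Gr gD
  rw [if_neg (by omega)]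
  intro i k hk1 hk2
  refine (hb i k hk1 hk2).trans ?_
  have hrow : ∀ r' < TV.base.n, ∑ t ∈ Finset.range TV.base.n,
      (IntervalD.mag (imget (TV.prodM kitOf wT j (qb * L) (s₁ - qb * L)) r' t)).toReal * (r * vre (TV.wVec j L s₀ M) t) ≤
      ((TV.gctx j L ((s₁ - 1) / L)).facOf (TV.prodM kitOf wT j ((s₁ - 1) / L * L) (s₁ - (s₁ - 1) / L * L))
          (TV.wVec j L s₀ ((s₁ - 1) / L - (s₀ / L + 1)))).toReal * r * (TV.toCertDataVW kitOf wT sc).ω j (TV.base.wk r') := by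
    intro r' hr'
    have e : ∑ t ∈ Finset.range TV.base.n,
        (IntervalD.mag (imget (TV.prodM kitOf wT j (qb * L) (s₁ - qb * L)) r' t)).toReal * (r * vre (TV.wVec j L s₀ M) t) =
        r * ∑ t ∈ Finset.range TV.base.n,
          (IntervalD.mag (imget (TV.prodM kitOf wT j (qb * L) (s₁ - qb * L)) r' t)).toReal * vre (TV.wVec j L s₀ M) t := by
      rw [Finset.mul_sum]; exact Finset.sum_congr rfl fun t _ => by ring
    rw [e]
    have hM' : (s₁ - 1) / L - (s₀ / L + 1) = M := by omega
    rw [← hqb, hM']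
    have hf := rowsum_le_facOf (sc := sc) j L qb hω (TV.prodM kitOf wT j (qb * L) (s₁ - qb * L)) (TV.wVec j L s₀ M) hr'
    calc r * _ ≤ r * (((TV.gctx j L qb).facOf (TV.prodM kitOf wT j (qb * L) (s₁ - qb * L)) (TV.wVec j L s₀ M)).toReal *
          (TV.toCertDataVW kitOf wT sc).ω j (TV.base.wk r')) := mul_le_mul_of_nonneg_left hf hr
      _ = _ := by ring
  have hw := TV.base.rowsum_window_le_of_coord cd_Kb cd_Ka _ (fun t => r * vre (TV.wVec j L s₀ M) t) _ hrow i hk1 hk2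
  refine hw.trans (le_of_eq ?_)
  rw [TV.base.wk_idx i (by rw [← cd_Kb (TV := TV) (kitOf := kitOf) (wT := wT) (sc := sc),
    ← cd_Ka (TV := TV) (kitOf := kitOf) (wT := wT) (sc := sc)]; exact ⟨hk1, hk2⟩)]

/-- **(R2) from the growth Booleans** (all pairs `s₀ ≤ s₁ ≤ S`). [folklore] -/
theorem hR2_of_growth (s₀ s₁ : ℕ) (h01 : s₀ ≤ s₁) (hS : s₁ ≤ TV.S j) (Ac : ℕ → Ker)
    (hA : ∀ s', s₀ ≤ s' → s' < s₁ →
      KerMem (TV.toCertDataVW kitOf wT sc) (Ac s') ((TV.toBoxesW kitOf wT).Mlo j s') ((TV.toBoxesW kitOf wT).Mhi j s'))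
    (v : Fin 4 → ℤ → ℝ) (r : ℝ) (hr : 0 ≤ r) (hv : (TV.toCertDataVW kitOf wT sc).InBall j v r) :
    (TV.toCertDataVW kitOf wT sc).InBall j (kiter (TV.toCertDataVW kitOf wT sc) Ac s₀ (s₁ - s₀) v)
      (TV.Gr kitOf wT j L s₀ s₁ * r) := by
  by_cases hin : s₁ ≤ (s₀ / L + 1) * L
  · exact hR2_inChunk (sc := sc) hω h01 hin Ac hA v r hr hv
  · exact hR2_cross (sc := sc) hL hGR hω hS hin Ac hA v r hr hv

end Stage

/-! ### (R0) and (R1) from their Booleans -/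

section R01

variable {j : ℕ}

/-- **(R1) from `checkR1`**: the level-1 hull inflated by the `ΛT·κ`-ball (`ΛT := Λdes`) lies in the outer hull. [folklore] -/
theorem hR1_of_check (hc : TV.checkR1 wT j = true) (s' : ℕ) (y d : Fin 4 → ℤ → ℝ)
    (hy : InBox (TV.toCertDataVW kitOf wT sc) ((TV.toBoxesW kitOf wT).hlo 1 j s') ((TV.toBoxesW kitOf wT).hhi 1 j s') y)
    (hd : (TV.toCertDataVW kitOf wT sc).InBall j d (TV.ΛTr j * (TV.toCertDataVW kitOf wT sc).κ j)) :
    InBox (TV.toCertDataVW kitOf wT sc) ((TV.toBoxesW kitOf wT).hlo 2 j s') ((TV.toBoxesW kitOf wT).hhi 2 j s') (y + d) := by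
  refine inBox_hull2_of_hull1_add (sc := sc) j s' hy fun i k hk1 hk2 => ?_
  have hk : -TV.base.Kb ≤ k ∧ k ≤ TV.base.Ka := ⟨hk1, hk2⟩
  have hc' := le_of_leVec hc (TV.base.idx_lt_n i hk)
  rw [TV.base.vecF_apply, if_pos hk]
  refine ((hd i k hk1 hk2).trans ?_).trans hc'
  -- `ΛT·κ·ω_k ≤ tubeW[idx i k]`
  have hmem := IntervalD.mem_mulR TV.prec (IntervalD.mem_ofQS2 TV.prec (TV.stageV j).Λdes)
    (mem_κωB (TV := TV) (kitOf := kitOf) (wT := wT) (sc := sc) j i k hk1 hk2)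
  unfold tubeW vre
  rw [dget_ofFn _ (TV.base.idx_lt_n i hk)]
  have e : TV.ΛTr j * (TV.toCertDataVW kitOf wT sc).κ j * (TV.toCertDataVW kitOf wT sc).ω j k =
      QS2.toRealHom (TV.stageV j).Λdes * ((TV.toCertDataVW kitOf wT sc).κ j * (TV.toCertDataVW kitOf wT sc).ω j k) := by
    unfold ΛTr; ring
  rw [e]
  exact hmem.2

/-- One face of the base point from `faceTest0`. [folklore] -/
theorem face0_of_test {l : ℕ} (h : TV.faceTest0 j l = true) :
    |(TV.toCertDataVW kitOf wT sc).ℓ j l ((TV.toCertDataVW kitOf wT sc).x j 0) - (TV.toCertDataVW kitOf wT sc).ctr j l| ≤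
      (TV.toCertDataVW kitOf wT sc).rad j l := by
  unfold faceTest0 at h
  have hle := (Dyad.ble_iff _ _).1 h
  have hrad : ((IntervalD.ofQS2 TV.prec (vget (TV.base.stage j).rad l)).lo).toReal ≤ (TV.toCertDataVW kitOf wT sc).rad j l :=
    (IntervalD.mem_ofQS2 TV.prec _).1
  refine le_trans ?_ (hle.trans hrad)
  refine IntervalD.abs_le_mag (IntervalD.mem_subR TV.prec ?_ (IntervalD.mem_ofQS2 TV.prec _))
  -- `ℓ_{j,l}(x_{j,0}) = Σ_c yb_c · ell_{l,c}`
  have e : (TV.toCertDataVW kitOf wT sc).ℓ j l ((TV.toCertDataVW kitOf wT sc).x j 0) =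
      ∑ c ∈ Finset.range TV.base.n, (dget (TV.stageV j).yb c).toReal * QS2.toRealHom (vget ((TV.base.stage j).ell.getD l []) c) := by
    show TV.base.covR QS2.toRealHom ((TV.base.stage j).ell.getD l []) (TV.xR j 0) = _
    rw [TV.base.covR_apply]
    refine Finset.sum_congr rfl fun c hc => ?_
    rw [TV.wv_xR j 0 (Finset.mem_range.1 hc), mul_comm]
    rfl
  rw [e]
  exact IntervalD.mem_rangeSumR TV.prec _ fun c _ => IntervalD.mem_mulDZ TV.prec _ (IntervalD.mem_ofQS2 TV.prec _)

/-- **(R0 a–d) from `checkR0`.** [folklore] -/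
theorem hR0_of_check (hc : TV.checkR0 j = true) :
    (TV.toCertDataVW kitOf wT sc).Tn j ((TV.toCertDataVW kitOf wT sc).S j) ≤ (TV.toCertDataVW kitOf wT sc).τs ∧
    InPoly (TV.toCertDataVW kitOf wT sc) j ((TV.toCertDataVW kitOf wT sc).x j 0) ∧
    0 < (TV.toCertDataVW kitOf wT sc).γ j ∧ 0 ≤ TV.ΛTr j := by
  unfold checkR0 checkInPoly0 at hc
  simp only [Bool.and_eq_true, decide_eq_true_eq, allN_eq_true] at hc
  obtain ⟨⟨⟨hT, hγ⟩, hΛ⟩, hP⟩ := hc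
  refine ⟨?_, fun l => ?_, ?_, ?_⟩
  · have h1 := (Dyad.ble_iff _ _).1 hT
    exact h1.trans (IntervalD.mem_ofQS2 TV.prec TV.base.τs).1
  · by_cases hl : l < max (max (TV.base.stage j).ell.length (TV.base.stage j).ctr.length) (TV.base.stage j).rad.length
    · exact face0_of_test (sc := sc) (hP l hl)
    · push Not at hl
      have h1 : (TV.base.stage j).ell.getD l [] = [] := List.getD_eq_default _ _ (by omega)
      have h2 : vget (TV.base.stage j).ctr l = 0 := vget_of_le _ (by omega)
      have h3 : vget (TV.base.stage j).rad l = 0 := vget_of_le _ (by omega)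
      show |TV.base.covR QS2.toRealHom ((TV.base.stage j).ell.getD l []) _ - QS2.toRealHom (vget (TV.base.stage j).ctr l)| ≤
        QS2.toRealHom (vget (TV.base.stage j).rad l)
      rw [h1, h2, h3, TV.base.covR_nil, map_zero]
      simp
  · have := (QS2.lt_iff_toR _ _).1 hγ
    rw [QS2.toR_zero] at this
    exact this
  · have := (QS2.le_iff_toR _ _).1 hΛ
    rw [QS2.toR_zero] at this
    exact this

end R01

/-! ### The five (R0)–(R3) inputs of the read-out composer, all stages (binders verbatim as in `readoutsV_of_checks`) -/

section All

variable {Pj : ℕ → ℕ → CoreOut → Bool} {L : ℕ} (hL : 0 < L)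
  (hGR : ∀ j, j ≤ TV.base.N₀ → ∀ q, q * L < TV.S j → TV.growthRange kitOf wT (Pj j) j L q = true)
  (hcL : ∀ j, j ≤ TV.base.N₀ → TV.checkL1 j = true)
  (hc0 : ∀ j, j ≤ TV.base.N₀ → TV.checkR0 j = true)
  (hc1 : ∀ j, j ≤ TV.base.N₀ → TV.checkR1 wT j = true)
  (hSN : (TV.toCertDataVW kitOf wT sc).StageNumerics)

include hc0 in
/-- (R0) for all stages. [folklore] -/
theorem hR0_all : ∀ j, j ≤ TV.base.N₀ →
    (TV.toCertDataVW kitOf wT sc).Tn j ((TV.toCertDataVW kitOf wT sc).S j) ≤ (TV.toCertDataVW kitOf wT sc).τs ∧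
    InPoly (TV.toCertDataVW kitOf wT sc) j ((TV.toCertDataVW kitOf wT sc).x j 0) ∧ 0 < (TV.toCertDataVW kitOf wT sc).γ j ∧
    0 ≤ TV.ΛTr j :=
  fun j hj => hR0_of_check (sc := sc) (hc0 j hj)

include hc1 in
/-- (R1) for all stages. [folklore] -/
theorem hR1_all : ∀ j, j ≤ TV.base.N₀ → ∀ s', s' ≤ (TV.toCertDataVW kitOf wT sc).S j → ∀ y d : Fin 4 → ℤ → ℝ,
    InBox (TV.toCertDataVW kitOf wT sc) ((TV.toBoxesW kitOf wT).hlo 1 j s') ((TV.toBoxesW kitOf wT).hhi 1 j s') y →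
    (TV.toCertDataVW kitOf wT sc).InBall j d (TV.ΛTr j * (TV.toCertDataVW kitOf wT sc).κ j) →
    InBox (TV.toCertDataVW kitOf wT sc) ((TV.toBoxesW kitOf wT).hlo 2 j s') ((TV.toBoxesW kitOf wT).hhi 2 j s') (y + d) :=
  fun j hj s' _ y d hy hd => hR1_of_check (sc := sc) (hc1 j hj) s' y d hy hd

include hL hGR hSN in
/-- (R2) for all stages. [folklore] -/
theorem hR2_all : ∀ j, j ≤ TV.base.N₀ → ∀ s₀ s₁, s₀ ≤ s₁ → s₁ ≤ (TV.toCertDataVW kitOf wT sc).S j → ∀ Ac : ℕ → Ker,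
    (∀ s', s₀ ≤ s' → s' < s₁ →
      KerMem (TV.toCertDataVW kitOf wT sc) (Ac s') ((TV.toBoxesW kitOf wT).Mlo j s') ((TV.toBoxesW kitOf wT).Mhi j s')) →
    ∀ (v : Fin 4 → ℤ → ℝ) (r : ℝ), 0 ≤ r → (TV.toCertDataVW kitOf wT sc).InBall j v r →
      (TV.toCertDataVW kitOf wT sc).InBall j (kiter (TV.toCertDataVW kitOf wT sc) Ac s₀ (s₁ - s₀) v)
        (TV.Gr kitOf wT j L s₀ s₁ * r) :=
  fun j hj s₀ s₁ h01 hS Ac hA v r hr hv =>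
    hR2_of_growth (sc := sc) hL (hGR j hj) (hSN.1 j hj).2.2.2.2.2.2.1 s₀ s₁ h01 hS Ac hA v r hr hv

include hL hGR in
/-- (R3a) for all stages. [folklore] -/
theorem hR3a_all : ∀ j, j ≤ TV.base.N₀ → ∀ a b, a < (TV.toCertDataVW kitOf wT sc).S j → a + 1 ≤ b →
    b ≤ (TV.toCertDataVW kitOf wT sc).S j →
    (TV.toCertDataVW kitOf wT sc).L1 j a * TV.Gr kitOf wT j L (a + 1) b ≤ TV.ΛTr j ∧
    (b < (TV.toCertDataVW kitOf wT sc).S j →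
      (TV.toCertDataVW kitOf wT sc).L1 j a * TV.Gr kitOf wT j L (a + 1) b * (TV.toCertDataVW kitOf wT sc).L1 j b ≤
        (TV.toCertDataVW kitOf wT sc).Λ j) :=
  fun j hj a b ha hab hb => hR3a_of_growth (sc := sc) hL (hGR j hj) a b ha hab hb

include hL hGR hcL in
/-- (R3b) for all stages. [folklore] -/
theorem hR3b_all : ∀ j, j ≤ TV.base.N₀ → ∀ a, a < (TV.toCertDataVW kitOf wT sc).S j →
    (TV.toCertDataVW kitOf wT sc).L1 j a ≤ (TV.toCertDataVW kitOf wT sc).Λ j :=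
  fun j hj a ha => hR3b_of_growth (sc := sc) hL (hGR j hj) (hcL j hj) a ha

include hL hGR in
/-- The chunk runs also deliver the chain Booleans (`ChecksOK.steps`) and the caller's per-sub-step predicate. [folklore] -/
theorem steps_of_growth : ∀ j, j ≤ TV.base.N₀ → ∀ s, s < TV.S j →
    ((TV.ctxOfW kitOf wT j).subStep s ((TV.ctxOfW kitOf wT j).nodeAt s)).ok = true ∧
    Pj j s ((TV.ctxOfW kitOf wT j).subStep s ((TV.ctxOfW kitOf wT j).nodeAt s)).core = true := by
  intro j hj s hs
  obtain ⟨h1, h2, -⟩ := facts_at (TV := TV) (kitOf := kitOf) (wT := wT) hL (hGR j hj) hs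
  exact ⟨h1, h2⟩

end All


end CertTablesV

end Summit.NavierStokesRegularity.NavierStokesRegularity.Theorems.TaylorModelCert
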